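import Summits.AtomisticToContinuum.Crystallization.Theorems.FrustratedLawDichotomyTwoShellRigidityCut

/-!
# FrustratedLawDichotomy · crux `AperiodicFrustratedLawGap` (stmt-AtomisticToContinuum-27623) — the SHARP COVERING CONSTANT of the 26 probes
# (decomp-a2c, prover hand 1, gen 11; lens-5 g32 NODE «gauged ladder» §6 ask «hand-1: (optional) `CoversProbes26`», ATTACKABLE·S, Mathlib-only)

lens-5's gauge-fixed directional ladder (g32, `TwoShellRigidityGaugedLadder`) reads every fit through a finite PROBE LIST `D` and converts
directional bounds into Euclidean ones through the COVERING CONSTANT `Covers D ρ : ∀ v, ∃ n ∈ D, ‖v‖ ≤ ρ·⟪n, v⟫`.  For the 26 probes of types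
`(100)`, `(110)/√2`, `(111)/√3` the sharp constant is `ρ₂₆ = √(9 − 2√2 − 2√6) = 1.1280930…` (the circumradius of the polar polytope, attained at
the vertex `(1, √2−1, √3−√2)`); lens-5 typed `CoversProbes26 : Covers probes26 (11281/10000)` and proved only the free fallback `ρ = √3`.

This def-free file PROVES it, with an EXACT degree-two certificate on the sorted chamber `a ≥ b ≥ c ≥ 0`:

  `(9 − 2√2 − 2√6)·M² − (a² + b² + c²) = (M−a)(a−b) + (√2M−a−b)(b−c) + (√3M−a−b−c)·c`
  `        + (2−√2)(M−a)M + (2√2−1−√3)(√2M−a−b)M + (√3−√2)(√3M−a−b−c)M`   (`sq_sum_le_of_sorted`),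

every term nonnegative when `a ≤ M`, `a + b ≤ √2M`, `a + b + c ≤ √3M` (the multipliers are the coordinates gaps of the extremal vertex; note
`2√2 − 1 − √3 = 0.096 > 0`).  Then `covers_probes26` : for every `v : E3` some probe `n` of the list (written VERBATIM as lens-5's
`axisProbes ++ diagProbes`, so that `CoversProbes26` follows by `fun v => covers_probes26 v` once that file is a tree module) has
`‖v‖ ≤ (11281/10000)·⟪n, v⟫` — take `n` maximising `⟪·, v⟫` over the list; the 26 inequalities `⟪n', v⟫ ≤ ⟪n, v⟫` are exactly the seven sorted-free
constraints on `(|v₀|, |v₁|, |v₂|)`; `9 − 2√2 − 2√6 ≤ (11281/10000)²` by `√2 ≥ 1.414213`, `√6 ≥ 2.449489` (margin `1.4·10⁻⁵`).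
`[folklore]` (elementary); def-free; no `sorry`.
-/

noncomputable section

namespace Summit.AtomisticToContinuum.Crystallization.Theorems.FrustratedLawDichotomyTwoShellRigidityProbeCovering

open Summit.AtomisticToContinuum.Crystallization.Theorems.FrustratedLawDichotomyTwoShellRigidityCut (E3)
open scoped RealInnerProductSpace

/-! ### The exact certificate on the sorted chamber -/

/-- `√2·√3 = √6`, `(√2)² = 2`, `(√3)² = 3`. [folklore] -/
theorem sqrt_facts : Real.sqrt 2 * Real.sqrt 3 = Real.sqrt 6 ∧ Real.sqrt 2 ^ 2 = 2 ∧ Real.sqrt 3 ^ 2 = 3 := by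
  refine ⟨?_, Real.sq_sqrt (by norm_num), Real.sq_sqrt (by norm_num)⟩
  rw [← Real.sqrt_mul (by norm_num : (0 : ℝ) ≤ 2)]; norm_num

/-- **The covering certificate on the sorted chamber** `a ≥ b ≥ c ≥ 0`: `a ≤ M`, `a + b ≤ √2·M`, `a + b + c ≤ √3·M` ⟹
`a² + b² + c² ≤ (9 − 2√2 − 2√6)·M²` (exact degree-two identity, see the module docstring). [folklore] -/
theorem sq_sum_le_of_sorted {a b c M : ℝ} (hM : 0 ≤ M) (hab : b ≤ a) (hbc : c ≤ b) (hc : 0 ≤ c) (h1 : a ≤ M)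
    (h2 : a + b ≤ Real.sqrt 2 * M) (h3 : a + b + c ≤ Real.sqrt 3 * M) :
    a ^ 2 + b ^ 2 + c ^ 2 ≤ (9 - 2 * Real.sqrt 2 - 2 * Real.sqrt 6) * M ^ 2 := by
  obtain ⟨h6, h22, h33⟩ := sqrt_facts
  have r2 : (1414 : ℝ) / 1000 ≤ Real.sqrt 2 := by
    rw [← Real.sqrt_sq (by norm_num : (0 : ℝ) ≤ 1414 / 1000)]; exact Real.sqrt_le_sqrt (by norm_num)
  have r2u : Real.sqrt 2 ≤ (1415 : ℝ) / 1000 := by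
    rw [← Real.sqrt_sq (by norm_num : (0 : ℝ) ≤ 1415 / 1000)]; exact Real.sqrt_le_sqrt (by norm_num)
  have r3 : (1732 : ℝ) / 1000 ≤ Real.sqrt 3 := by
    rw [← Real.sqrt_sq (by norm_num : (0 : ℝ) ≤ 1732 / 1000)]; exact Real.sqrt_le_sqrt (by norm_num)
  have lA : 0 ≤ 2 - Real.sqrt 2 := by linarith
  have lB : 0 ≤ 2 * Real.sqrt 2 - 1 - Real.sqrt 3 := by
    have r3u : Real.sqrt 3 ≤ (1733 : ℝ) / 1000 := by
      rw [← Real.sqrt_sq (by norm_num : (0 : ℝ) ≤ 1733 / 1000)]; exact Real.sqrt_le_sqrt (by norm_num)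
    linarith
  have lC : 0 ≤ Real.sqrt 3 - Real.sqrt 2 := by linarith
  have pA : 0 ≤ (M - a) * (a - b) := mul_nonneg (by linarith) (by linarith)
  have pB : 0 ≤ (Real.sqrt 2 * M - a - b) * (b - c) := mul_nonneg (by linarith) (by linarith)
  have pC : 0 ≤ (Real.sqrt 3 * M - a - b - c) * c := mul_nonneg (by linarith) hc
  have qA : 0 ≤ (2 - Real.sqrt 2) * ((M - a) * M) := mul_nonneg lA (mul_nonneg (by linarith) hM)
  have qB : 0 ≤ (2 * Real.sqrt 2 - 1 - Real.sqrt 3) * ((Real.sqrt 2 * M - a - b) * M) :=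
    mul_nonneg lB (mul_nonneg (by linarith) hM)
  have qC : 0 ≤ (Real.sqrt 3 - Real.sqrt 2) * ((Real.sqrt 3 * M - a - b - c) * M) := mul_nonneg lC (mul_nonneg (by linarith) hM)
  have key : (9 - 2 * Real.sqrt 2 - 2 * Real.sqrt 6) * M ^ 2 - (a ^ 2 + b ^ 2 + c ^ 2) =
      (M - a) * (a - b) + (Real.sqrt 2 * M - a - b) * (b - c) + (Real.sqrt 3 * M - a - b - c) * c +
        (2 - Real.sqrt 2) * ((M - a) * M) + (2 * Real.sqrt 2 - 1 - Real.sqrt 3) * ((Real.sqrt 2 * M - a - b) * M) +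
        (Real.sqrt 3 - Real.sqrt 2) * ((Real.sqrt 3 * M - a - b - c) * M) := by
    have e6 : Real.sqrt 6 = Real.sqrt 2 * Real.sqrt 3 := h6.symm
    rw [e6]
    ring_nf
    rw [h22, h33]
    ring
  linarith

/-- The symmetric form: for `a, b, c ≥ 0` with `a, b, c ≤ M`, the three pair sums `≤ √2·M` and `a + b + c ≤ √3·M`:
`a² + b² + c² ≤ (9 − 2√2 − 2√6)·M²` (sort and apply `sq_sum_le_of_sorted`). [folklore] -/
theorem sq_sum_le_of_bounds {a b c M : ℝ} (hM : 0 ≤ M) (ha : 0 ≤ a) (hb : 0 ≤ b) (hc : 0 ≤ c) (h1a : a ≤ M) (h1b : b ≤ M)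
    (h1c : c ≤ M) (hab : a + b ≤ Real.sqrt 2 * M) (hac : a + c ≤ Real.sqrt 2 * M) (hbc : b + c ≤ Real.sqrt 2 * M)
    (h3 : a + b + c ≤ Real.sqrt 3 * M) : a ^ 2 + b ^ 2 + c ^ 2 ≤ (9 - 2 * Real.sqrt 2 - 2 * Real.sqrt 6) * M ^ 2 := by
  rcases le_total b a with h_ba | h_ab
  · rcases le_total c b with h_cb | h_bc
    · exact sq_sum_le_of_sorted hM h_ba h_cb hc h1a hab h3
    · rcases le_total c a with h_ca | h_ac
      · have := sq_sum_le_of_sorted hM h_ca h_bc hb h1a hac (by linarith); linarith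
      · have := sq_sum_le_of_sorted hM h_ac h_ba hb h1c (by linarith) (by linarith); linarith
  · rcases le_total c a with h_ca | h_ac
    · have := sq_sum_le_of_sorted hM h_ab h_ca hc h1b (by linarith) (by linarith); linarith
    · rcases le_total c b with h_cb | h_bc
      · have := sq_sum_le_of_sorted hM h_cb h_ac ha h1b hbc (by linarith); linarith
      · have := sq_sum_le_of_sorted hM h_bc h_ab ha h1c (by linarith) (by linarith); linarith

/-- The numerical margin: `9 − 2√2 − 2√6 ≤ (11281/10000)²` (`1.272594 ≤ 1.272610`). [folklore] -/
theorem rho_sq_bound : 9 - 2 * Real.sqrt 2 - 2 * Real.sqrt 6 ≤ ((11281 : ℝ) / 10000) ^ 2 := by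
  have r2 : (1414213 : ℝ) / 1000000 ≤ Real.sqrt 2 := by
    rw [← Real.sqrt_sq (by norm_num : (0 : ℝ) ≤ 1414213 / 1000000)]; exact Real.sqrt_le_sqrt (by norm_num)
  have r6 : (2449489 : ℝ) / 1000000 ≤ Real.sqrt 6 := by
    rw [← Real.sqrt_sq (by norm_num : (0 : ℝ) ≤ 2449489 / 1000000)]; exact Real.sqrt_le_sqrt (by norm_num)
  nlinarith

/-! ### Inner products with the probes -/

/-- `⟪(a, b, c), v⟫ = a·v₀ + b·v₁ + c·v₂`. [folklore] -/
theorem inner_toLp3 (a b c : ℝ) (v : E3) : ⟪(WithLp.toLp 2 ![a, b, c] : E3), v⟫ = a * v 0 + b * v 1 + c * v 2 := by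
  simp [PiLp.inner_apply, Fin.sum_univ_three, mul_comm]

/-! ### The covering constant of the 26 probes -/

/-- The 26 directional inequalities in coordinates (`s = 1/√2`, `t = 1/√3`) give `x₀² + x₁² + x₂² ≤ (11281/10000·M)²` and `0 ≤ M`. [folklore] -/
theorem covering_arith {x0 x1 x2 M s t : ℝ} (hs2 : s * Real.sqrt 2 = 1) (ht3 : t * Real.sqrt 3 = 1)
    (a0 : x0 ≤ M) (a1 : x1 ≤ M) (a2 : x2 ≤ M) (a3 : -x0 ≤ M) (a4 : -x1 ≤ M) (a5 : -x2 ≤ M) (d0 : s * x0 + s * x1 ≤ M) (d1 : s * x0 - s * x1 ≤ M)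
    (d2 : -s * x0 + s * x1 ≤ M) (d3 : -s * x0 - s * x1 ≤ M) (d4 : s * x0 + s * x2 ≤ M) (d5 : s * x0 - s * x2 ≤ M) (d6 : -s * x0 + s * x2 ≤ M)
    (d7 : -s * x0 - s * x2 ≤ M) (d8 : s * x1 + s * x2 ≤ M) (d9 : s * x1 - s * x2 ≤ M) (d10 : -s * x1 + s * x2 ≤ M) (d11 : -s * x1 - s * x2 ≤ M)
    (t0 : t * x0 + t * x1 + t * x2 ≤ M) (t1 : t * x0 + t * x1 - t * x2 ≤ M) (t2 : t * x0 - t * x1 + t * x2 ≤ M) (t3 : t * x0 - t * x1 - t * x2 ≤ M)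
    (t4 : -t * x0 + t * x1 + t * x2 ≤ M) (t5 : -t * x0 + t * x1 - t * x2 ≤ M) (t6 : -t * x0 - t * x1 + t * x2 ≤ M)
    (t7 : -t * x0 - t * x1 - t * x2 ≤ M) :
    x0 ^ 2 + x1 ^ 2 + x2 ^ 2 ≤ ((11281 : ℝ) / 10000 * M) ^ 2 ∧ 0 ≤ M := by
  have ha : |x0| ≤ M := abs_le.2 ⟨by linarith, a0⟩
  have hb : |x1| ≤ M := abs_le.2 ⟨by linarith, a1⟩
  have hc : |x2| ≤ M := abs_le.2 ⟨by linarith, a2⟩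
  have hM0 : 0 ≤ M := (abs_nonneg _).trans ha
  have conv2 : ∀ {p q : ℝ}, s * p + s * q ≤ M → p + q ≤ Real.sqrt 2 * M := by
    intro p q h
    have h' := mul_le_mul_of_nonneg_left h (Real.sqrt_nonneg 2)
    have e : Real.sqrt 2 * (s * p + s * q) = (s * Real.sqrt 2) * (p + q) := by ring
    rw [e, hs2, one_mul] at h'
    exact h'
  have conv3 : ∀ {p q r : ℝ}, t * p + t * q + t * r ≤ M → p + q + r ≤ Real.sqrt 3 * M := by
    intro p q r h
    have h' := mul_le_mul_of_nonneg_left h (Real.sqrt_nonneg 3)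
    have e : Real.sqrt 3 * (t * p + t * q + t * r) = (t * Real.sqrt 3) * (p + q + r) := by ring
    rw [e, ht3, one_mul] at h'
    exact h'
  have hab : |x0| + |x1| ≤ Real.sqrt 2 * M := by
    rcases abs_cases x0 with ⟨h0, _⟩ | ⟨h0, _⟩ <;> rcases abs_cases x1 with ⟨h1, _⟩ | ⟨h1, _⟩ <;> rw [h0, h1] <;>
      apply conv2 <;> linarith
  have hac : |x0| + |x2| ≤ Real.sqrt 2 * M := by
    rcases abs_cases x0 with ⟨h0, _⟩ | ⟨h0, _⟩ <;> rcases abs_cases x2 with ⟨h2, _⟩ | ⟨h2, _⟩ <;> rw [h0, h2] <;>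
      apply conv2 <;> linarith
  have hbc : |x1| + |x2| ≤ Real.sqrt 2 * M := by
    rcases abs_cases x1 with ⟨h1, _⟩ | ⟨h1, _⟩ <;> rcases abs_cases x2 with ⟨h2, _⟩ | ⟨h2, _⟩ <;> rw [h1, h2] <;>
      apply conv2 <;> linarith
  have habc : |x0| + |x1| + |x2| ≤ Real.sqrt 3 * M := by
    rcases abs_cases x0 with ⟨h0, _⟩ | ⟨h0, _⟩ <;> rcases abs_cases x1 with ⟨h1, _⟩ | ⟨h1, _⟩ <;>
      rcases abs_cases x2 with ⟨h2, _⟩ | ⟨h2, _⟩ <;> rw [h0, h1, h2] <;> apply conv3 <;> linarith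
  have hsq := sq_sum_le_of_bounds hM0 (abs_nonneg _) (abs_nonneg _) (abs_nonneg _) ha hb hc hab hac hbc habc
  rw [sq_abs, sq_abs, sq_abs] at hsq
  have hρ := rho_sq_bound
  refine ⟨?_, hM0⟩
  rw [mul_pow]
  nlinarith [sq_nonneg M]

/-- **`Covers probes26 (11281/10000)`, def-free**: for every `v : E3` some probe `n` of lens-5's list `axisProbes ++ diagProbes` (written
verbatim) satisfies `‖v‖ ≤ (11281/10000)·⟪n, v⟫.  This is the body of lens-5 g32's `CoversProbes26`. [folklore] -/
theorem covers_probes26 : ∀ v : E3, ∃ n ∈ ([(EuclideanSpace.single 0 (1 : ℝ) : E3), (EuclideanSpace.single 1 (1 : ℝ) : E3), (EuclideanSpace.single 2 (1 : ℝ) : E3), (-EuclideanSpace.single 0 (1 : ℝ) : E3), (-EuclideanSpace.single 1 (1 : ℝ) : E3), (-EuclideanSpace.single 2 (1 : ℝ) : E3)] ++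
      [(WithLp.toLp 2 ![(Real.sqrt 2)⁻¹, (Real.sqrt 2)⁻¹, 0] : E3),
      (WithLp.toLp 2 ![(Real.sqrt 2)⁻¹, (-(Real.sqrt 2)⁻¹), 0] : E3),
      (WithLp.toLp 2 ![(-(Real.sqrt 2)⁻¹), (Real.sqrt 2)⁻¹, 0] : E3),
      (WithLp.toLp 2 ![(-(Real.sqrt 2)⁻¹), (-(Real.sqrt 2)⁻¹), 0] : E3),
      (WithLp.toLp 2 ![(Real.sqrt 2)⁻¹, 0, (Real.sqrt 2)⁻¹] : E3),
      (WithLp.toLp 2 ![(Real.sqrt 2)⁻¹, 0, (-(Real.sqrt 2)⁻¹)] : E3),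
      (WithLp.toLp 2 ![(-(Real.sqrt 2)⁻¹), 0, (Real.sqrt 2)⁻¹] : E3),
      (WithLp.toLp 2 ![(-(Real.sqrt 2)⁻¹), 0, (-(Real.sqrt 2)⁻¹)] : E3),
      (WithLp.toLp 2 ![0, (Real.sqrt 2)⁻¹, (Real.sqrt 2)⁻¹] : E3),
      (WithLp.toLp 2 ![0, (Real.sqrt 2)⁻¹, (-(Real.sqrt 2)⁻¹)] : E3),
      (WithLp.toLp 2 ![0, (-(Real.sqrt 2)⁻¹), (Real.sqrt 2)⁻¹] : E3),
      (WithLp.toLp 2 ![0, (-(Real.sqrt 2)⁻¹), (-(Real.sqrt 2)⁻¹)] : E3),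
      (WithLp.toLp 2 ![(Real.sqrt 3)⁻¹, (Real.sqrt 3)⁻¹, (Real.sqrt 3)⁻¹] : E3),
      (WithLp.toLp 2 ![(Real.sqrt 3)⁻¹, (Real.sqrt 3)⁻¹, (-(Real.sqrt 3)⁻¹)] : E3),
      (WithLp.toLp 2 ![(Real.sqrt 3)⁻¹, (-(Real.sqrt 3)⁻¹), (Real.sqrt 3)⁻¹] : E3),
      (WithLp.toLp 2 ![(Real.sqrt 3)⁻¹, (-(Real.sqrt 3)⁻¹), (-(Real.sqrt 3)⁻¹)] : E3),
      (WithLp.toLp 2 ![(-(Real.sqrt 3)⁻¹), (Real.sqrt 3)⁻¹, (Real.sqrt 3)⁻¹] : E3),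
      (WithLp.toLp 2 ![(-(Real.sqrt 3)⁻¹), (Real.sqrt 3)⁻¹, (-(Real.sqrt 3)⁻¹)] : E3),
      (WithLp.toLp 2 ![(-(Real.sqrt 3)⁻¹), (-(Real.sqrt 3)⁻¹), (Real.sqrt 3)⁻¹] : E3),
      (WithLp.toLp 2 ![(-(Real.sqrt 3)⁻¹), (-(Real.sqrt 3)⁻¹), (-(Real.sqrt 3)⁻¹)] : E3)]),
    ‖v‖ ≤ (11281 : ℝ) / 10000 * ⟪n, v⟫ := by
  classical
  intro v
  obtain ⟨L, hL⟩ : ∃ L : List E3, L = ([(EuclideanSpace.single 0 (1 : ℝ) : E3), (EuclideanSpace.single 1 (1 : ℝ) : E3), (EuclideanSpace.single 2 (1 : ℝ) : E3), (-EuclideanSpace.single 0 (1 : ℝ) : E3), (-EuclideanSpace.single 1 (1 : ℝ) : E3), (-EuclideanSpace.single 2 (1 : ℝ) : E3)] ++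
      [(WithLp.toLp 2 ![(Real.sqrt 2)⁻¹, (Real.sqrt 2)⁻¹, 0] : E3),
      (WithLp.toLp 2 ![(Real.sqrt 2)⁻¹, (-(Real.sqrt 2)⁻¹), 0] : E3),
      (WithLp.toLp 2 ![(-(Real.sqrt 2)⁻¹), (Real.sqrt 2)⁻¹, 0] : E3),
      (WithLp.toLp 2 ![(-(Real.sqrt 2)⁻¹), (-(Real.sqrt 2)⁻¹), 0] : E3),
      (WithLp.toLp 2 ![(Real.sqrt 2)⁻¹, 0, (Real.sqrt 2)⁻¹] : E3),
      (WithLp.toLp 2 ![(Real.sqrt 2)⁻¹, 0, (-(Real.sqrt 2)⁻¹)] : E3),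
      (WithLp.toLp 2 ![(-(Real.sqrt 2)⁻¹), 0, (Real.sqrt 2)⁻¹] : E3),
      (WithLp.toLp 2 ![(-(Real.sqrt 2)⁻¹), 0, (-(Real.sqrt 2)⁻¹)] : E3),
      (WithLp.toLp 2 ![0, (Real.sqrt 2)⁻¹, (Real.sqrt 2)⁻¹] : E3),
      (WithLp.toLp 2 ![0, (Real.sqrt 2)⁻¹, (-(Real.sqrt 2)⁻¹)] : E3),
      (WithLp.toLp 2 ![0, (-(Real.sqrt 2)⁻¹), (Real.sqrt 2)⁻¹] : E3),
      (WithLp.toLp 2 ![0, (-(Real.sqrt 2)⁻¹), (-(Real.sqrt 2)⁻¹)] : E3),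
      (WithLp.toLp 2 ![(Real.sqrt 3)⁻¹, (Real.sqrt 3)⁻¹, (Real.sqrt 3)⁻¹] : E3),
      (WithLp.toLp 2 ![(Real.sqrt 3)⁻¹, (Real.sqrt 3)⁻¹, (-(Real.sqrt 3)⁻¹)] : E3),
      (WithLp.toLp 2 ![(Real.sqrt 3)⁻¹, (-(Real.sqrt 3)⁻¹), (Real.sqrt 3)⁻¹] : E3),
      (WithLp.toLp 2 ![(Real.sqrt 3)⁻¹, (-(Real.sqrt 3)⁻¹), (-(Real.sqrt 3)⁻¹)] : E3),
      (WithLp.toLp 2 ![(-(Real.sqrt 3)⁻¹), (Real.sqrt 3)⁻¹, (Real.sqrt 3)⁻¹] : E3),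
      (WithLp.toLp 2 ![(-(Real.sqrt 3)⁻¹), (Real.sqrt 3)⁻¹, (-(Real.sqrt 3)⁻¹)] : E3),
      (WithLp.toLp 2 ![(-(Real.sqrt 3)⁻¹), (-(Real.sqrt 3)⁻¹), (Real.sqrt 3)⁻¹] : E3),
      (WithLp.toLp 2 ![(-(Real.sqrt 3)⁻¹), (-(Real.sqrt 3)⁻¹), (-(Real.sqrt 3)⁻¹)] : E3)]) := ⟨_, rfl⟩
  rw [← hL]
  -- a maximising probe
  have hne : L.toFinset.Nonempty := ⟨EuclideanSpace.single 0 (1 : ℝ), by rw [List.mem_toFinset, hL]; exact List.mem_cons_self⟩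
  obtain ⟨n, hn, hmax⟩ := L.toFinset.exists_max_image (fun n : E3 => ⟪n, v⟫) hne
  refine ⟨n, List.mem_toFinset.1 hn, ?_⟩
  have hM : ∀ k : Fin 26, ∀ hk : (k : ℕ) < L.length, ⟪L[(k : ℕ)], v⟫ ≤ ⟪n, v⟫ :=
    fun k hk => hmax _ (List.mem_toFinset.2 (List.getElem_mem hk))
  obtain ⟨M, hMdef⟩ : ∃ M : ℝ, ⟪n, v⟫ = M := ⟨_, rfl⟩
  rw [hMdef] at hM ⊢
  have hlen : L.length = 26 := by rw [hL]; rfl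
  subst hL
  have a0 := hM ⟨0, by norm_num⟩ (by rw [hlen]; norm_num)
  simp only [List.getElem_cons_zero, List.cons_append, List.nil_append, EuclideanSpace.inner_single_left, map_one, one_mul] at a0
  have a1 := hM ⟨1, by norm_num⟩ (by rw [hlen]; norm_num)
  simp only [List.getElem_cons_succ, List.getElem_cons_zero, List.cons_append, List.nil_append, EuclideanSpace.inner_single_left, map_one, one_mul] at a1
  have a2 := hM ⟨2, by norm_num⟩ (by rw [hlen]; norm_num)
  simp only [List.getElem_cons_succ, List.getElem_cons_zero, List.cons_append, List.nil_append, EuclideanSpace.inner_single_left, map_one, one_mul] at a2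
  have a3 := hM ⟨3, by norm_num⟩ (by rw [hlen]; norm_num)
  simp only [List.getElem_cons_succ, List.getElem_cons_zero, List.cons_append, List.nil_append, inner_neg_left, EuclideanSpace.inner_single_left, map_one, one_mul] at a3
  have a4 := hM ⟨4, by norm_num⟩ (by rw [hlen]; norm_num)
  simp only [List.getElem_cons_succ, List.getElem_cons_zero, List.cons_append, List.nil_append, inner_neg_left, EuclideanSpace.inner_single_left, map_one, one_mul] at a4
  have a5 := hM ⟨5, by norm_num⟩ (by rw [hlen]; norm_num)
  simp only [List.getElem_cons_succ, List.getElem_cons_zero, List.cons_append, List.nil_append, inner_neg_left, EuclideanSpace.inner_single_left, map_one, one_mul] at a5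
  have d0 := hM ⟨6, by norm_num⟩ (by rw [hlen]; norm_num)
  simp only [List.getElem_cons_succ, List.getElem_cons_zero, List.cons_append, List.nil_append, inner_toLp3] at d0
  have d1 := hM ⟨7, by norm_num⟩ (by rw [hlen]; norm_num)
  simp only [List.getElem_cons_succ, List.getElem_cons_zero, List.cons_append, List.nil_append, inner_toLp3] at d1
  have d2 := hM ⟨8, by norm_num⟩ (by rw [hlen]; norm_num)
  simp only [List.getElem_cons_succ, List.getElem_cons_zero, List.cons_append, List.nil_append, inner_toLp3] at d2
  have d3 := hM ⟨9, by norm_num⟩ (by rw [hlen]; norm_num)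
  simp only [List.getElem_cons_succ, List.getElem_cons_zero, List.cons_append, List.nil_append, inner_toLp3] at d3
  have d4 := hM ⟨10, by norm_num⟩ (by rw [hlen]; norm_num)
  simp only [List.getElem_cons_succ, List.getElem_cons_zero, List.cons_append, List.nil_append, inner_toLp3] at d4
  have d5 := hM ⟨11, by norm_num⟩ (by rw [hlen]; norm_num)
  simp only [List.getElem_cons_succ, List.getElem_cons_zero, List.cons_append, List.nil_append, inner_toLp3] at d5
  have d6 := hM ⟨12, by norm_num⟩ (by rw [hlen]; norm_num)
  simp only [List.getElem_cons_succ, List.getElem_cons_zero, List.cons_append, List.nil_append, inner_toLp3] at d6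
  have d7 := hM ⟨13, by norm_num⟩ (by rw [hlen]; norm_num)
  simp only [List.getElem_cons_succ, List.getElem_cons_zero, List.cons_append, List.nil_append, inner_toLp3] at d7
  have d8 := hM ⟨14, by norm_num⟩ (by rw [hlen]; norm_num)
  simp only [List.getElem_cons_succ, List.getElem_cons_zero, List.cons_append, List.nil_append, inner_toLp3] at d8
  have d9 := hM ⟨15, by norm_num⟩ (by rw [hlen]; norm_num)
  simp only [List.getElem_cons_succ, List.getElem_cons_zero, List.cons_append, List.nil_append, inner_toLp3] at d9
  have d10 := hM ⟨16, by norm_num⟩ (by rw [hlen]; norm_num)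
  simp only [List.getElem_cons_succ, List.getElem_cons_zero, List.cons_append, List.nil_append, inner_toLp3] at d10
  have d11 := hM ⟨17, by norm_num⟩ (by rw [hlen]; norm_num)
  simp only [List.getElem_cons_succ, List.getElem_cons_zero, List.cons_append, List.nil_append, inner_toLp3] at d11
  have t0 := hM ⟨18, by norm_num⟩ (by rw [hlen]; norm_num)
  simp only [List.getElem_cons_succ, List.getElem_cons_zero, List.cons_append, List.nil_append, inner_toLp3] at t0
  have t1 := hM ⟨19, by norm_num⟩ (by rw [hlen]; norm_num)
  simp only [List.getElem_cons_succ, List.getElem_cons_zero, List.cons_append, List.nil_append, inner_toLp3] at t1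
  have t2 := hM ⟨20, by norm_num⟩ (by rw [hlen]; norm_num)
  simp only [List.getElem_cons_succ, List.getElem_cons_zero, List.cons_append, List.nil_append, inner_toLp3] at t2
  have t3 := hM ⟨21, by norm_num⟩ (by rw [hlen]; norm_num)
  simp only [List.getElem_cons_succ, List.getElem_cons_zero, List.cons_append, List.nil_append, inner_toLp3] at t3
  have t4 := hM ⟨22, by norm_num⟩ (by rw [hlen]; norm_num)
  simp only [List.getElem_cons_succ, List.getElem_cons_zero, List.cons_append, List.nil_append, inner_toLp3] at t4
  have t5 := hM ⟨23, by norm_num⟩ (by rw [hlen]; norm_num)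
  simp only [List.getElem_cons_succ, List.getElem_cons_zero, List.cons_append, List.nil_append, inner_toLp3] at t5
  have t6 := hM ⟨24, by norm_num⟩ (by rw [hlen]; norm_num)
  simp only [List.getElem_cons_succ, List.getElem_cons_zero, List.cons_append, List.nil_append, inner_toLp3] at t6
  have t7 := hM ⟨25, by norm_num⟩ (by rw [hlen]; norm_num)
  simp only [List.getElem_cons_succ, List.getElem_cons_zero, List.cons_append, List.nil_append, inner_toLp3] at t7

  have hs2 : (Real.sqrt 2)⁻¹ * Real.sqrt 2 = 1 := inv_mul_cancel₀ (by positivity)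
  have ht3 : (Real.sqrt 3)⁻¹ * Real.sqrt 3 = 1 := inv_mul_cancel₀ (by positivity)
  obtain ⟨hsq, hM0⟩ := covering_arith hs2 ht3 a0 a1 a2 (by linarith) (by linarith) (by linarith)
    (by linarith) (by linarith) (by linarith) (by linarith) (by linarith) (by linarith) (by linarith) (by linarith)
    (by linarith) (by linarith) (by linarith) (by linarith)
    (by linarith) (by linarith) (by linarith) (by linarith) (by linarith) (by linarith) (by linarith) (by linarith)
  have hnorm : ‖v‖ ^ 2 = v 0 ^ 2 + v 1 ^ 2 + v 2 ^ 2 := by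
    rw [EuclideanSpace.real_norm_sq_eq, Fin.sum_univ_three]
  exact (sq_le_sq₀ (norm_nonneg _) (by positivity)).1 (by rw [hnorm]; exact hsq)

end Summit.AtomisticToContinuum.Crystallization.Theorems.FrustratedLawDichotomyTwoShellRigidityProbeCovering

end
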